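import Literature.NumberTheory.EllipticCurves.FormalGroupFrobeniusTypeProofs
import Literature.NumberTheory.EllipticCurves.FormalGroupMultiplicationUniversalProofs
import HarnessLib

/-!
# The formal group of an elliptic curve over `𝔽_p` has finite height: `[p]˜ ≠ 0` (proofs only)

Topic `NumberTheory/EllipticCurves` (theorems only; no definition, no named fact). For an odd prime
`p` and a Weierstrass equation `V` over `ℤ_p` with elliptic generic and special fibres, the
multiplication-by-`p` series of the reduced formal group `Ẽ^` is NONZERO in `𝔽_p⟦X⟧`
(`formalMul_prime_map_toZMod_ne_zero`) — the reduction has finite height (Silverman AEC IV.7.4 /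
V.3: height `1` or `2`). Consequently `[n]˜ ≠ 0` for every `n ≥ 1` (`formalMul_map_toZMod_ne_zero`)
and some coefficient of `[n]` over `ℤ_p` in positive degree is a unit
(`exists_isUnit_coeff_formalMul`) — the finite-height hypothesis of the local lemma
`Literature.RingTheory.PowerSeries.padicInt_exists_map_eq_of_subst_eq_map` in the finite-height
route to the integrality of the Manin constant (`NeronIsogenyScaling.lean`).

Proof: by the tree's Frobenius identity in `End(Ẽ^)` (`frobenius_formal_identity_of_nonneg/neg`:
`F̃(X^{p²}, [p]˜X) = [a]˜(Xᵖ)`, resp. `ĩ([|a|]˜(Xᵖ))`, `a = p + 1 − #Ẽ(𝔽_p)`), `[p]˜ = 0` would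
give `X^{p²} = ±[|a|]˜(Xᵖ)`; comparing the coefficients of `Xᵖ` gives `p ∣ a`, whence
`[|a|]˜ = [p]˜ ∘ [|a|/p]˜ = 0` and `X^{p²} = 0`, absurd.

## References

* J. H. Silverman, *The Arithmetic of Elliptic Curves*, 2nd ed. (2009), IV.7 (height), V.3,
  Thm. V.2.3.1(b). [SilvermanAEC2009]
* T. Honda, J. Math. Soc. Japan 22 (1970), §6.2 (proof of Thm. 9). [Honda1970]
-/

noncomputable section

open scoped Classical

namespace WeierstrassCurve

open PowerSeries Literature.NumberTheory.EllipticCurves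

/-! ### Substitution helpers -/

section Helpers

variable {R : Type*} [CommRing R]

/-- `0(g) = 0`. [folklore] -/
theorem zero_subst_eq_zero {g : R⟦X⟧} (hg : HasSubst g) : (0 : R⟦X⟧).subst g = 0 := by
  rw [← coe_substAlgHom hg, map_zero]

/-- `f(0) = 0` for `f(0) = 0`. This is Mathlib's `PowerSeries.subst_zero_of_constantCoeff_zero`;
kept as a deprecated alias (dedup-02515). [folklore] -/
@[deprecated PowerSeries.subst_zero_of_constantCoeff_zero (since := "2026-08-16")]
theorem subst_zero_eq_zero {f : R⟦X⟧} (hf : constantCoeff f = 0) : f.subst (0 : R⟦X⟧) = 0 :=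
  PowerSeries.subst_zero_of_constantCoeff_zero hf

/-- `[X¹] f(g) = [X¹]f · [X¹]g` for `g(0) = 0`. [folklore] -/
theorem coeff_one_subst_eq_mul (f : R⟦X⟧) {g : R⟦X⟧} (hg : constantCoeff g = 0) :
    coeff 1 (f.subst g) = coeff 1 f * coeff 1 g := by
  rw [coeff_subst' (HasSubst.of_constantCoeff_zero' hg), finsum_eq_single _ 1]
  · rw [pow_one, smul_eq_mul]
  · intro d hd
    rcases Nat.lt_or_gt_of_ne hd with h0 | h2
    · rw [Nat.lt_one_iff.mp h0, pow_zero, coeff_one, if_neg one_ne_zero, smul_zero]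
    · rw [X_pow_dvd_iff.mp (pow_dvd_pow_of_dvd (X_dvd_iff.mpr hg) d) 1 h2, smul_zero]

end Helpers

/-! ### Finite height -/

section FiniteHeight

variable {p : ℕ} [hp : Fact p.Prime] (V : WeierstrassCurve ℤ_[p])
  [hE : (V.map PadicInt.Coe.ringHom).IsElliptic] [hEt : (V.map PadicInt.toZMod).IsElliptic]

/-- **The reduced formal group has finite height: `[p]˜ ≠ 0` in `𝔽_p⟦X⟧`** (`p` odd, elliptic
fibres). [cite: SilvermanAEC2009, Thm. V.2.3.1(b)] -/
theorem formalMul_prime_map_toZMod_ne_zero (hp2 : p ≠ 2) : (V.map PadicInt.toZMod).formalMul p ≠ 0 := by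
  intro h0
  have hp0 : p ≠ 0 := hp.out.ne_zero
  have hp1 : 1 < p := hp.out.one_lt
  have hpp : ¬ p ^ 2 = p := by
    intro h; rw [sq] at h; exact absurd (mul_right_cancel₀ hp0 (h.trans (one_mul p).symm)) hp.out.ne_one
  set E := V.map PadicInt.toZMod with hEdef
  have hXp : HasSubst ((X : (ZMod p)⟦X⟧) ^ p) := HasSubst.X_pow hp0
  have hXne : (X : (ZMod p)⟦X⟧) ^ p ^ 2 ≠ 0 := pow_ne_zero _ X_ne_zero
  -- the left-hand side of the Frobenius identity collapses to `X^{p²}`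
  have hLHS : MvPowerSeries.subst ![(X : (ZMod p)⟦X⟧) ^ p ^ 2, (E.formalMul p).subst (X : (ZMod p)⟦X⟧)]
      E.formalGroupLaw = (X : (ZMod p)⟦X⟧) ^ p ^ 2 := by
    rw [h0, zero_subst_eq_zero HasSubst.X',
      E.formalGroupLaw_subst_pair_zero_right (constantCoeff_X_pow' (pow_ne_zero 2 hp0))]
  -- `[m]˜ = 0` as soon as `p ∣ m`
  have hmul : ∀ m : ℕ, p ∣ m → E.formalMul m = 0 := by
    rintro m ⟨k, rfl⟩
    rw [← E.formalMul_mul_subst' p k, h0, zero_subst_eq_zero (E.hasSubst_formalMul k)]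
  -- coefficient of `Xᵖ` of a series of the form `h(Xᵖ)`
  have hcoeff : ∀ h : (ZMod p)⟦X⟧, coeff p (h.subst ((X : (ZMod p)⟦X⟧) ^ p)) = coeff 1 h := fun h ↦ by
    rw [coeff_subst_X_pow hp0, if_pos dvd_rfl, Nat.div_self hp.out.pos]; rfl
  have hcoeffL : coeff p ((X : (ZMod p)⟦X⟧) ^ p ^ 2) = 0 := by rw [coeff_X_pow, if_neg (Ne.symm hpp)]
  rcases le_or_gt 0 (Literature.NumberTheory.EllipticCurves.HasseManin.tr E) with ha | ha
  · have hid := V.frobenius_formal_identity_of_nonneg hp2 ha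
    rw [← hEdef] at hid
    rw [hLHS] at hid
    have hc := congrArg (coeff p) hid
    rw [hcoeffL, hcoeff, coeff_one_formalMul'] at hc
    have hdvd : p ∣ (Literature.NumberTheory.EllipticCurves.HasseManin.tr E).toNat :=
      (ZMod.natCast_eq_zero_iff _ _).mp hc.symm
    rw [hmul _ hdvd, zero_subst_eq_zero hXp] at hid
    exact hXne hid
  · have hid := V.frobenius_formal_identity_of_neg hp2 ha
    rw [← hEdef] at hid
    rw [hLHS, ← subst_comp_subst_apply (E.hasSubst_formalMul _) hXp] at hid
    have hc := congrArg (coeff p) hid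
    rw [hcoeffL, hcoeff, coeff_one_subst_eq_mul _ (E.constantCoeff_formalMul _), coeff_one_formalNeg,
      coeff_one_formalMul', neg_one_mul, eq_comm, neg_eq_zero] at hc
    have hdvd : p ∣ (Literature.NumberTheory.EllipticCurves.HasseManin.tr E).natAbs :=
      (ZMod.natCast_eq_zero_iff _ _).mp hc
    rw [hmul _ hdvd, PowerSeries.subst_zero_of_constantCoeff_zero E.constantCoeff_formalNeg,
      zero_subst_eq_zero hXp] at hid
    exact hXne hid

/-- `f(g) ≠ 0` for `f ≠ 0` and `g = uX + ⋯` with `u` a unit (compose with `g⁻¹`). [folklore] -/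
theorem subst_ne_zero_of_isUnit_coeff_one {k : Type*} [CommRing k] {f g : k⟦X⟧} (hf : f ≠ 0)
    (hg0 : constantCoeff g = 0) (hg1 : IsUnit (coeff 1 g)) : f.subst g ≠ 0 := by
  intro h
  apply hf
  have hs : HasSubst (g.substInvOfIsUnit hg1) := HasSubst.substInvOfIsUnit g hg1
  have key := congrArg (PowerSeries.subst (g.substInvOfIsUnit hg1)) h
  rwa [zero_subst_eq_zero hs, subst_comp_subst_apply (HasSubst.of_constantCoeff_zero' hg0) hs,
    subst_substInvOfIsUnit_right g hg0 hg1, powerSeries_subst_X_self] at key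

/-- **Composition of nonzero series without constant term over a domain is nonzero**: the
coefficient of `X^{ij}` of `f(g)`, `i = ord f`, `j = ord g`, is `fᵢ gⱼⁱ`. [folklore] -/
theorem subst_ne_zero_of_ne_zero {k : Type*} [CommRing k] [IsDomain k] {f g : k⟦X⟧} (hf : f ≠ 0)
    (hg0 : constantCoeff g = 0) (hg : g ≠ 0) : f.subst g ≠ 0 := by
  classical
  have hexf : ∃ n, coeff n f ≠ 0 := exists_coeff_ne_zero_iff_ne_zero.mpr hf
  have hexg : ∃ n, coeff n g ≠ 0 := exists_coeff_ne_zero_iff_ne_zero.mpr hg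
  set i := Nat.find hexf with hi
  set j := Nat.find hexg with hj
  have hfi : coeff i f ≠ 0 := Nat.find_spec hexf
  have hgj : coeff j g ≠ 0 := Nat.find_spec hexg
  have hflt : ∀ d < i, coeff d f = 0 := fun d hd ↦ not_not.mp (Nat.find_min hexf hd)
  have hglt : ∀ d < j, coeff d g = 0 := fun d hd ↦ not_not.mp (Nat.find_min hexg hd)
  have hj0 : 0 < j := by
    rcases Nat.eq_zero_or_pos j with h | h
    · exact absurd (by rw [← coeff_zero_eq_constantCoeff_apply, ← h] at hg0; exact hg0) hgj
    · exact h
  -- `g = Xʲ g'` with `g'(0) = gⱼ ≠ 0`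
  obtain ⟨g', hg'⟩ : (X : k⟦X⟧) ^ j ∣ g := X_pow_dvd_iff.mpr hglt
  have hg'0 : constantCoeff g' = coeff j g := by
    rw [hg', coeff_X_pow_mul', if_pos le_rfl, Nat.sub_self, coeff_zero_eq_constantCoeff_apply]
  have hsg : HasSubst g := HasSubst.of_constantCoeff_zero' hg0
  intro h0
  have hc : coeff (i * j) (f.subst g) = coeff i f * (constantCoeff g') ^ i := by
    rw [coeff_subst' hsg, finsum_eq_single _ i]
    · rw [smul_eq_mul, hg', mul_pow, ← pow_mul, mul_comm j i, coeff_X_pow_mul', if_pos le_rfl,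
        Nat.sub_self, coeff_zero_eq_constantCoeff_apply, map_pow]
    · intro d hd
      rcases Nat.lt_or_gt_of_ne hd with hlt | hgt
      · rw [hflt d hlt, zero_smul]
      · rw [hg', mul_pow, ← pow_mul, coeff_X_pow_mul', if_neg, smul_zero]
        rw [not_le]
        calc i * j < d * j := Nat.mul_lt_mul_of_pos_right hgt hj0
          _ = j * d := mul_comm _ _
  rw [h0, map_zero] at hc
  exact (mul_ne_zero hfi (pow_ne_zero _ (hg'0 ▸ hgj))) hc.symm

/-- **`[n]˜ ≠ 0` for every `n ≥ 1`** (`p` odd, elliptic fibres): `[pᵏm]˜ = [pᵏ]˜ ∘ [m]˜` with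
`[m]˜ = mX + ⋯`, `p ∤ m`, and `[pᵏ]˜ = [p]˜ ∘ ⋯ ∘ [p]˜ ≠ 0`. [cite: SilvermanAEC2009, IV.7] -/
theorem formalMul_map_toZMod_ne_zero (hp2 : p ≠ 2) {n : ℕ} (hn : 0 < n) :
    (V.map PadicInt.toZMod).formalMul n ≠ 0 := by
  set E := V.map PadicInt.toZMod with hEdef
  have hp0 : p ≠ 0 := hp.out.ne_zero
  have hP := V.formalMul_prime_map_toZMod_ne_zero hp2
  rw [← hEdef] at hP
  have hpow : ∀ k : ℕ, E.formalMul (p ^ k) ≠ 0 := by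
    intro k
    induction k with
    | zero => rw [pow_zero]; intro h; have := congrArg (coeff 1) h
              rw [coeff_one_formalMul', Nat.cast_one, map_zero] at this; exact one_ne_zero this
    | succ k ih =>
      rw [pow_succ', ← E.formalMul_mul_subst' p (p ^ k)]
      exact subst_ne_zero_of_ne_zero hP (E.constantCoeff_formalMul _) ih
  obtain ⟨k, m, hm, rfl⟩ := Nat.exists_eq_pow_mul_and_not_dvd hn.ne' p hp.out.ne_one
  rw [← E.formalMul_mul_subst' (p ^ k) m]
  refine subst_ne_zero_of_ne_zero (hpow k) (E.constantCoeff_formalMul m) fun h ↦ ?_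
  have := congrArg (coeff 1) h
  rw [coeff_one_formalMul', map_zero] at this
  exact hm ((ZMod.natCast_eq_zero_iff m p).mp this)

omit hE hEt in
/-- A `p`-adic integer whose reduction is nonzero is a unit. [folklore] -/
theorem _root_.Literature.NumberTheory.EllipticCurves.isUnit_of_toZMod_ne_zero {x : ℤ_[p]}
    (hx : PadicInt.toZMod x ≠ 0) : IsUnit x := by
  by_contra h
  apply hx
  have hmem : x ∈ IsLocalRing.maximalIdeal ℤ_[p] := (IsLocalRing.mem_maximalIdeal _).mpr h
  rw [← PadicInt.ker_toZMod] at hmem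
  exact hmem

/-- **Some coefficient of `[n](θ(X))` in positive degree is a `p`-adic unit** for `n ≥ 1` and a
change of parameter `θ = uX + ⋯ ∈ ℤ_p⟦X⟧`, `u ∈ ℤ_pˣ` (`p` odd, elliptic fibres) — the
finite-height hypothesis of `Literature.RingTheory.PowerSeries.padicInt_exists_map_eq_of_subst_eq_map`.
[cite: SilvermanAEC2009, IV.7] -/
theorem exists_isUnit_coeff_formalMul_subst (hp2 : p ≠ 2) {n : ℕ} (hn : 0 < n) {θ : ℤ_[p]⟦X⟧}
    (hθ0 : constantCoeff θ = 0) (hθ1 : IsUnit (coeff 1 θ)) :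
    ∃ d : ℕ, 0 < d ∧ IsUnit (coeff d ((V.formalMul n).subst θ)) := by
  have hsθ : HasSubst θ := HasSubst.of_constantCoeff_zero' hθ0
  have hms : PowerSeries.map PadicInt.toZMod ((V.formalMul n).subst θ) =
      ((V.map PadicInt.toZMod).formalMul n).subst (PowerSeries.map PadicInt.toZMod θ) := by
    rw [powerSeries_map_subst _ hsθ, map_formalMul]
  have hne : PowerSeries.map PadicInt.toZMod ((V.formalMul n).subst θ) ≠ 0 := by
    rw [hms]
    refine subst_ne_zero_of_isUnit_coeff_one (V.formalMul_map_toZMod_ne_zero hp2 hn) ?_ ?_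
    · rw [← coeff_zero_eq_constantCoeff_apply, coeff_map, coeff_zero_eq_constantCoeff_apply, hθ0,
        map_zero]
    · rw [coeff_map]; exact hθ1.map _
  obtain ⟨d, hd⟩ := exists_coeff_ne_zero_iff_ne_zero.mpr hne
  rw [coeff_map] at hd
  refine ⟨d, Nat.pos_of_ne_zero ?_, isUnit_of_toZMod_ne_zero hd⟩
  rintro rfl
  apply hd
  rw [coeff_zero_eq_constantCoeff_apply, constantCoeff_subst_eq_constantCoeff hθ0,
    V.constantCoeff_formalMul n, map_zero]

/-- The same for `[n]` itself (`θ = X`). [cite: SilvermanAEC2009, IV.7] -/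
theorem exists_isUnit_coeff_formalMul (hp2 : p ≠ 2) {n : ℕ} (hn : 0 < n) :
    ∃ d : ℕ, 0 < d ∧ IsUnit (coeff d (V.formalMul n)) := by
  have h := V.exists_isUnit_coeff_formalMul_subst hp2 hn (θ := X) constantCoeff_X
    (by rw [coeff_one_X]; exact isUnit_one)
  rwa [powerSeries_subst_X_self] at h

end FiniteHeight

end WeierstrassCurve
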